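import Mathlib
import Summits.MatrixMultiplication.MatrixMultiplication.Theorems.SnSubsetDichotomyHyperoctahedralThresholdPatternRefl

/-!
# `SnSubsetDichotomy.HyperoctahedralThreshold` — twin defect census (twins `ℓ²` route of the open core)

Crux `stmt-MatrixMultiplication-10883`, line `refutation-local-symmetry`, open core `stub_poorRigidCore`
(POOR ∧ RIGID ⇒ one clean closed rung walk avoiding `R`).  The twins route to the core (crux NOTES §§4, 11)
counts, for a cyclically reduced colour word `z`, the ordered pairs `(x, y)` of distinct fixed points of `z`
("based twin pre-ladders") against their DEFECTS.  This file is the exact, hypothesis-free bookkeeping of that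
count for ONE word, and the extraction of the clean walk when the count is positive:

* (imported) `patternPair_cleanWalk` (tree, `…PatternRefl.lean`, siege k20) — two fixed points `x, y` of `z`
  with identical self-coincidence patterns, no cross-coincidence `x·z.take s = y·z.take t`, and `R`-free
  trajectories give clean closed-rung-walk data in the format of the core's conclusion (`k + 1 = |z|` rungs).
* `twin_defect_census` — with `F = Fix z`,
  `|F|² ≤ |F| + #Good + 2·#SC·|F| + #X + 2·|z|·|R|·|F|`, where `Good ⊆ F²` are the pairs as in
  `patternPair_cleanWalk`, `SC = {(x, s, t) : x ∈ F, s < t, x·z.take s = x·z.take t}` (self-coincidences) and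
  `X = {(x, y, s, t) : x, y ∈ F, s ≠ t, x·z.take s = y·z.take t}` (cross-coincidences = slides, the `Ξ` of crux
  NOTES §4/§11).  Proof: an off-diagonal pair that is not good either meets `R` (at most `|z|·|R|` members of `F`
  do, by injectivity of `v ↦ v·z.take t`: `2|z||R||F|` pairs), or has a pattern mismatch (then one of its two
  points has a self-coincidence: `2·#SC·|F|` pairs), or a cross-coincidence at `s ≠ t` (`#X` pairs; `s = t` would
  force `x = y`).
* `stub_twinCensus` (registered stub, `--supports stmt-MatrixMultiplication-10883`) — the TWINS `ℓ²` CRITERION: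
  if `|F|² > |F| + 2·#SC·|F| + #X + 2|z||R||F|` for a cyclically reduced `z` of length `≥ 2`, the core's
  conclusion holds with `k + 1 = |z|`.

Together with the landed supplies (`stub_twinSupplyCS`, `stub_closedWalkSupplyCyclic`: the twin mass
`Σ_z (|F_z|² − |F_z|)` is large at some scale `≤ 4 log₂ n + O(1)`) this makes the twins route formal down to upper
bounds for the three defect masses `Σ_z #SC_z|F_z|` (poorness + dense-spot factor, crux NOTES §11),
`Σ_z #X_z` (the weak-mixing statement (WM) — the open atom) and the forbidden mass.

Conventions as in the line: `μ c : Equiv.Perm (Fin n)`, a word `z : List (Fin 3)` acts by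
`v · z = z.foldl (fun v c => μ c v) v`, trajectories `t ↦ v · z.take t` for `t : Fin z.length`.
No involution / fixed-point-freeness hypothesis is needed anywhere in this file.
-/

set_option linter.dupNamespace false

namespace Summit.MatrixMultiplication.MatrixMultiplication.Theorems.HyperoctahedralThreshold

open Equiv

namespace TwinDefectCensus

/-- **Twin defect census** for one word `z` (no hypothesis on `μ`, `z`).  With `F = Fix z`:
`|F|·|F| ≤ |F| + #Good + 2·(#SC·|F|) + #X + 2·(|z|·|R|·|F|)` — diagonal pairs, good pairs, pattern
mismatches (charged to a self-coincidence `(x, s < t)` of one of the two points), cross-coincidences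
`x·z.take s = y·z.take t` with `s ≠ t`, and pairs meeting `R` (at most `|z|·|R|` fixed points have a
trajectory point in `R`, by injectivity of `v ↦ v·z.take t`). [this line; crux NOTES §4/§11 bookkeeping] -/
theorem twin_defect_census (n : ℕ) (μ : Fin 3 → Equiv.Perm (Fin n)) (R : Finset (Fin n))
    (z : List (Fin 3)) :
    ((Finset.univ : Finset (Fin n)).filter (fun x => z.foldl (fun v c => μ c v) x = x)).card *
        ((Finset.univ : Finset (Fin n)).filter (fun x => z.foldl (fun v c => μ c v) x = x)).card ≤
      ((Finset.univ : Finset (Fin n)).filter (fun x => z.foldl (fun v c => μ c v) x = x)).card +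
      ((((Finset.univ : Finset (Fin n)).filter (fun x => z.foldl (fun v c => μ c v) x = x)) ×ˢ
          ((Finset.univ : Finset (Fin n)).filter (fun x => z.foldl (fun v c => μ c v) x = x))).filter
        (fun p => (∀ s t : Fin z.length, ((z.take (s : ℕ)).foldl (fun v c => μ c v) p.1 =
            (z.take (t : ℕ)).foldl (fun v c => μ c v) p.1 ↔
          (z.take (s : ℕ)).foldl (fun v c => μ c v) p.2 = (z.take (t : ℕ)).foldl (fun v c => μ c v) p.2)) ∧
          (∀ s t : Fin z.length, (z.take (s : ℕ)).foldl (fun v c => μ c v) p.1 ≠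
            (z.take (t : ℕ)).foldl (fun v c => μ c v) p.2) ∧
          (∀ t : Fin z.length, (z.take (t : ℕ)).foldl (fun v c => μ c v) p.1 ∉ R) ∧
          (∀ t : Fin z.length, (z.take (t : ℕ)).foldl (fun v c => μ c v) p.2 ∉ R))).card +
      2 * (((((Finset.univ : Finset (Fin n)).filter (fun x => z.foldl (fun v c => μ c v) x = x)) ×ˢ
            (Finset.univ : Finset (Fin z.length)) ×ˢ (Finset.univ : Finset (Fin z.length))).filter
          (fun q => q.2.1 < q.2.2 ∧ (z.take (q.2.1 : ℕ)).foldl (fun v c => μ c v) q.1 =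
            (z.take (q.2.2 : ℕ)).foldl (fun v c => μ c v) q.1)).card *
        ((Finset.univ : Finset (Fin n)).filter (fun x => z.foldl (fun v c => μ c v) x = x)).card) +
      ((((Finset.univ : Finset (Fin n)).filter (fun x => z.foldl (fun v c => μ c v) x = x)) ×ˢ
          ((Finset.univ : Finset (Fin n)).filter (fun x => z.foldl (fun v c => μ c v) x = x)) ×ˢ
          (Finset.univ : Finset (Fin z.length)) ×ˢ (Finset.univ : Finset (Fin z.length))).filter
        (fun q => q.2.2.1 ≠ q.2.2.2 ∧ (z.take (q.2.2.1 : ℕ)).foldl (fun v c => μ c v) q.1 =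
          (z.take (q.2.2.2 : ℕ)).foldl (fun v c => μ c v) q.2.1)).card +
      2 * (z.length * R.card *
        ((Finset.univ : Finset (Fin n)).filter (fun x => z.foldl (fun v c => μ c v) x = x)).card) := by
  classical
  -- abbreviations
  set F : Finset (Fin n) :=
    (Finset.univ : Finset (Fin n)).filter (fun x => z.foldl (fun v c => μ c v) x = x) with hF
  set T : ℕ → Fin n → Fin n := fun t v => (z.take t).foldl (fun v c => μ c v) v with hT
  have hTi : ∀ t, Function.Injective (T t) := fun t => GoodTwin.foldl_injective μ (z.take t)
  -- the four defect families
  set Good := (F ×ˢ F).filter (fun p => (∀ s t : Fin z.length, (T s p.1 = T t p.1 ↔ T s p.2 = T t p.2)) ∧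
      (∀ s t : Fin z.length, T s p.1 ≠ T t p.2) ∧ (∀ t : Fin z.length, T t p.1 ∉ R) ∧
      (∀ t : Fin z.length, T t p.2 ∉ R)) with hGood
  set SC := (F ×ˢ (Finset.univ : Finset (Fin z.length)) ×ˢ (Finset.univ : Finset (Fin z.length))).filter
      (fun q => q.2.1 < q.2.2 ∧ T q.2.1 q.1 = T q.2.2 q.1) with hSC
  set X := (F ×ˢ F ×ˢ (Finset.univ : Finset (Fin z.length)) ×ˢ (Finset.univ : Finset (Fin z.length))).filter
      (fun q => q.2.2.1 ≠ q.2.2.2 ∧ T q.2.2.1 q.1 = T q.2.2.2 q.2.1) with hX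
  set Bx := F.filter (fun x => ∃ t : Fin z.length, T t x ∈ R) with hBx
  show F.card * F.card ≤ F.card + Good.card + 2 * (SC.card * F.card) + X.card +
    2 * (z.length * R.card * F.card)
  -- (0) diagonal / off-diagonal pairs
  have h0 : F.card * F.card ≤ F.card + F.offDiag.card := by
    rw [Finset.offDiag_card, add_comm]
    exact le_tsub_add
  -- (1) at most `|z|·|R|` fixed points have a trajectory point in `R`
  have hBxcard : Bx.card ≤ z.length * R.card := by
    calc Bx.card
        ≤ ((Finset.univ : Finset (Fin z.length)).biUnion fun t =>
            F.filter (fun x => T t x ∈ R)).card := by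
          refine Finset.card_le_card fun x hx => ?_
          obtain ⟨hxF, t, ht⟩ := Finset.mem_filter.1 hx
          exact Finset.mem_biUnion.2 ⟨t, Finset.mem_univ _, Finset.mem_filter.2 ⟨hxF, ht⟩⟩
      _ ≤ (Finset.univ : Finset (Fin z.length)).card * R.card :=
          Finset.card_biUnion_le_card_mul _ _ _ fun t _ =>
            Finset.card_le_card_of_injOn (T t)
              (fun x hx => (Finset.mem_filter.1 (Finset.mem_coe.1 hx)).2) (hTi t).injOn
      _ = z.length * R.card := by rw [Finset.card_univ, Fintype.card_fin]
  -- (2) every off-diagonal pair is good or defective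
  set A2 := Bx ×ˢ F with hA2
  set A3 := F ×ˢ Bx with hA3
  set A4 := (SC ×ˢ F).image (fun q => (q.1.1, q.2)) with hA4
  set A5 := (SC ×ˢ F).image (fun q => (q.2, q.1.1)) with hA5
  set A6 := X.image (fun q => (q.1, q.2.1)) with hA6
  have hsplit : F.offDiag ⊆ Good ∪ A2 ∪ A3 ∪ A4 ∪ A5 ∪ A6 := by
    rintro ⟨x, y⟩ hp
    obtain ⟨hxF, hyF, hxy⟩ := Finset.mem_offDiag.1 hp
    simp only [Finset.mem_union]
    by_cases hR : ∃ t : Fin z.length, T t x ∈ R ∨ T t y ∈ R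
    · obtain ⟨t, ht | ht⟩ := hR
      · exact Or.inl (Or.inl (Or.inl (Or.inl (Or.inr
          (Finset.mem_product.2 ⟨Finset.mem_filter.2 ⟨hxF, t, ht⟩, hyF⟩)))))
      · exact Or.inl (Or.inl (Or.inl (Or.inr
          (Finset.mem_product.2 ⟨hxF, Finset.mem_filter.2 ⟨hyF, t, ht⟩⟩))))
    · push Not at hR
      by_cases hmis : ∃ s t : Fin z.length, ¬ (T s x = T t x ↔ T s y = T t y)
      · obtain ⟨s, t, hst⟩ := hmis
        by_cases hA : T s x = T t x
        · -- `x` has a self-coincidence at `{s, t}` (and `y` has not)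
          have hB : ¬ T s y = T t y := fun hB => hst ⟨fun _ => hB, fun _ => hA⟩
          have hne : s ≠ t := by
            rintro rfl
            exact hB rfl
          refine Or.inl (Or.inl (Or.inr ?_))
          rcases lt_or_gt_of_ne hne with h | h
          · exact Finset.mem_image.2 ⟨((x, (s, t)), y), Finset.mem_product.2
              ⟨Finset.mem_filter.2 ⟨Finset.mem_product.2 ⟨hxF, Finset.mem_product.2
                ⟨Finset.mem_univ _, Finset.mem_univ _⟩⟩, h, hA⟩, hyF⟩, rfl⟩
          · exact Finset.mem_image.2 ⟨((x, (t, s)), y), Finset.mem_product.2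
              ⟨Finset.mem_filter.2 ⟨Finset.mem_product.2 ⟨hxF, Finset.mem_product.2
                ⟨Finset.mem_univ _, Finset.mem_univ _⟩⟩, h, hA.symm⟩, hyF⟩, rfl⟩
        · -- `y` has a self-coincidence at `{s, t}` (and `x` has not)
          have hB : T s y = T t y := by
            by_contra hB
            exact hst ⟨fun h => absurd h hA, fun h => absurd h hB⟩
          have hne : s ≠ t := by
            rintro rfl
            exact hA rfl
          refine Or.inl (Or.inr ?_)
          rcases lt_or_gt_of_ne hne with h | h
          · exact Finset.mem_image.2 ⟨((y, (s, t)), x), Finset.mem_product.2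
              ⟨Finset.mem_filter.2 ⟨Finset.mem_product.2 ⟨hyF, Finset.mem_product.2
                ⟨Finset.mem_univ _, Finset.mem_univ _⟩⟩, h, hB⟩, hxF⟩, rfl⟩
          · exact Finset.mem_image.2 ⟨((y, (t, s)), x), Finset.mem_product.2
              ⟨Finset.mem_filter.2 ⟨Finset.mem_product.2 ⟨hyF, Finset.mem_product.2
                ⟨Finset.mem_univ _, Finset.mem_univ _⟩⟩, h, hB.symm⟩, hxF⟩, rfl⟩
      · push Not at hmis
        by_cases hcr : ∃ s t : Fin z.length, T s x = T t y
        · -- a cross-coincidence, necessarily at `s ≠ t` since `x ≠ y`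
          obtain ⟨s, t, hst⟩ := hcr
          have hne : s ≠ t := by
            rintro rfl
            exact hxy (hTi s hst)
          exact Or.inr (Finset.mem_image.2 ⟨(x, (y, (s, t))), Finset.mem_filter.2
            ⟨Finset.mem_product.2 ⟨hxF, Finset.mem_product.2 ⟨hyF, Finset.mem_product.2
              ⟨Finset.mem_univ _, Finset.mem_univ _⟩⟩⟩, hne, hst⟩, rfl⟩)
        · -- a good pair
          push Not at hcr
          exact Or.inl (Or.inl (Or.inl (Or.inl (Or.inl (Finset.mem_filter.2
            ⟨Finset.mem_product.2 ⟨hxF, hyF⟩, hmis, hcr, fun t => (hR t).1, fun t => (hR t).2⟩)))))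
  -- (3) bookkeeping
  have hcard := Finset.card_le_card hsplit
  have e5 := Finset.card_union_le (Good ∪ A2 ∪ A3 ∪ A4 ∪ A5) A6
  have e4 := Finset.card_union_le (Good ∪ A2 ∪ A3 ∪ A4) A5
  have e3 := Finset.card_union_le (Good ∪ A2 ∪ A3) A4
  have e2 := Finset.card_union_le (Good ∪ A2) A3
  have e1 := Finset.card_union_le Good A2
  have h2 : A2.card = Bx.card * F.card := Finset.card_product _ _
  have h3 : A3.card = F.card * Bx.card := Finset.card_product _ _
  have h4 : A4.card ≤ SC.card * F.card := Finset.card_image_le.trans (Finset.card_product _ _).le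
  have h5 : A5.card ≤ SC.card * F.card := Finset.card_image_le.trans (Finset.card_product _ _).le
  have h6 : A6.card ≤ X.card := Finset.card_image_le
  have hBF : Bx.card * F.card ≤ z.length * R.card * F.card := Nat.mul_le_mul_right _ hBxcard
  have hFB : F.card * Bx.card ≤ z.length * R.card * F.card := by
    rw [mul_comm]
    exact hBF
  linarith

/-- **Registered stub `stub_twinCensus` — the twins `ℓ²` criterion.**  For a cyclically reduced word `z` of
length `≥ 2` with fixed-point set `F`: if the twin mass `|F|²` exceeds
`|F| + 2·#SC·|F| + #X + 2·|z|·|R|·|F|` (diagonal + self-coincidence + cross-coincidence + forbidden masses, see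
`twin_defect_census`), then some pair of fixed points is good and the tree's `patternPair_cleanWalk` yields clean
closed-rung-walk data avoiding `R` with `k + 1 = |z|` rungs — the conclusion format of the open core
`stub_poorRigidCore`. [this line; crux NOTES §§4, 11] -/
theorem stub_twinCensus : ∀ (n : ℕ) (μ : Fin 3 → Equiv.Perm (Fin n)) (R : Finset (Fin n)) (z : List (Fin 3)), 2 ≤ z.length → List.IsChain (· ≠ ·) (z ++ z) → ((Finset.univ : Finset (Fin n)).filter (fun x => z.foldl (fun v c => μ c v) x = x)).card + 2 * (((((Finset.univ : Finset (Fin n)).filter (fun x => z.foldl (fun v c => μ c v) x = x)) ×ˢ (Finset.univ : Finset (Fin z.length)) ×ˢ (Finset.univ : Finset (Fin z.length))).filter (fun q => q.2.1 < q.2.2 ∧ (z.take (q.2.1 : ℕ)).foldl (fun v c => μ c v) q.1 = (z.take (q.2.2 : ℕ)).foldl (fun v c => μ c v) q.1)).card * ((Finset.univ : Finset (Fin n)).filter (fun x => z.foldl (fun v c => μ c v) x = x)).card) + ((((Finset.univ : Finset (Fin n)).filter (fun x => z.foldl (fun v c => μ c v) x = x)) ×ˢ ((Finset.univ : Finset (Fin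 n)).filter (fun x => z.foldl (fun v c => μ c v) x = x)) ×ˢ (Finset.univ : Finset (Fin z.length)) ×ˢ (Finset.univ : Finset (Fin z.length))).filter (fun q => q.2.2.1 ≠ q.2.2.2 ∧ (z.take (q.2.2.1 : ℕ)).foldl (fun v c => μ c v) q.1 = (z.take (q.2.2.2 : ℕ)).foldl (fun v c => μ c v) q.2.1)).card + 2 * (z.length * R.card * ((Finset.univ : Finset (Fin n)).filter (fun x => z.foldl (fun v c => μ c v) x = x)).card) < ((Finset.univ : Finset (Fin n)).filter (fun x => z.foldl (fun v c => μ c v) x = x)).card * ((Finset.univ : Finset (Fin n)).filter (fun x => z.foldl (fun v c => μ c v) x = x)).card → ∃ (k : ℕ) (p q : Fin (k + 1) → Fin n) (col : Fin (k + 1) → Fin 3), (∀ i, p i ≠ q i) ∧ (∀ i, (μ (col i) (p i) = p (i + 1) ∧ μ (col i) (q i) = q (i + 1)) ∨ (μ (col i) (p i) = q (i + 1) ∧ μ (col i) (q i) = p (i + 1))) ∧ (∀ i, col i ≠ col (i + 1)) ∧ (∀ i j, (p i = p j ∧ q i = q j) ∨ (p i = q j ∧ q i = p j) ∨ (p i ≠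 p j ∧ p i ≠ q j ∧ q i ≠ p j ∧ q i ≠ q j)) ∧ (∀ i, p i ∉ R ∧ q i ∉ R) ∧ k + 1 = z.length := by
  intro n μ R z hlen hchain hlt
  have hc := twin_defect_census n μ R z
  set F : Finset (Fin n) :=
    (Finset.univ : Finset (Fin n)).filter (fun x => z.foldl (fun v c => μ c v) x = x) with hF
  set T : ℕ → Fin n → Fin n := fun t v => (z.take t).foldl (fun v c => μ c v) v with hT
  set Good := (F ×ˢ F).filter (fun p => (∀ s t : Fin z.length, (T s p.1 = T t p.1 ↔ T s p.2 = T t p.2)) ∧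
      (∀ s t : Fin z.length, T s p.1 ≠ T t p.2) ∧ (∀ t : Fin z.length, T t p.1 ∉ R) ∧
      (∀ t : Fin z.length, T t p.2 ∉ R)) with hGood
  have hpos : 0 < Good.card := by linarith
  obtain ⟨⟨x, y⟩, hxy⟩ := Finset.card_pos.1 hpos
  obtain ⟨hmem, hpat, hcross, hxR, hyR⟩ := Finset.mem_filter.1 hxy
  obtain ⟨hxF, hyF⟩ := Finset.mem_product.1 hmem
  exact patternPair_cleanWalk n μ R z x y hlen hchain (Finset.mem_filter.1 hxF).2
    (Finset.mem_filter.1 hyF).2 hpat hcross hxR hyR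

end TwinDefectCensus

end Summit.MatrixMultiplication.MatrixMultiplication.Theorems.HyperoctahedralThreshold
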